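import Literature.Probability.FitznerVanDerHofstad2017.BlockSummation
import HarnessLib

/-!
# [FvdH17] §5.1/§6.2.1 — the block chain over the extended class index `ι ⊕ Unit` ("junction special")

R. Fitzner and R. van der Hofstad, *Mean-field behavior for nearest-neighbor percolation in `d > 10`*,
Electron. J. Probab. **22** (2017) no. 43; arXiv:1506.07977v2 — §5.1 "Elements of the bounds" (p. 49), (5.4)
(p. 48), Prop. 5.5 (5.34) (p. 53), §6.2.1 (6.48)–(6.49) and Lemma 6.1 (pp. 65–67): "we recursively define
`P^{(N),b}(u_N,w_N) = Σ … P^{(N−1),b}(u_{N−1},w_{N−1}) B^{κ,a,b}(u_{N−1},w_{N−1},w_N,u_N)` … `(B)_{a,b} =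
sup_v Σ_{ι,x,y} B^{ι,a,b}(0,v,x,y)` … `(Ā^ι)_{a,b} = sup_{v,y} Σ_{ι,x} …`".

## What this module is (typed skeleton of the NoBLE bounding-diagram algebra, one extra class)

In the typed derivation of the `N ≥ 2` bounds the level classes `a_i ∈ {0,1,2}` (length class of the shared
line `(u_i, w_i)`) are supplemented by ONE extra class `★ := Sum.inr ()` recording a SPECIAL JUNCTION: the next
level passes through the adjoined vertex `u_{i−1}` instead of through the cluster `C̃_i` (the case the printed
derivation absorbs silently).  On a special junction the shared slot `w_i` carries the PIN (`= u_{i−1}`), level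
`i` is CLOSED (no exit vertex: its block ends at `u_i` with both sausage ends) and level `i+1` is PINNED (its
line `t_i → z_i` ends at the pin, `z_i = w_i`).  This module supplies the pure `[0,∞]`-algebra of that extension,
generic in the group `G`, the class type `ι` and the direction type `K`, with the four special block families as
PARAMETERS (`Ec` closed, `Eo` pinned, `Eoc` pinned-and-closed, `EA` pinned terminal):

* `starS`, `starB`, `starA` (and `starS` again for `P^E`): the extended families over `ι ⊕ Unit`
  (`S ★ = 0`; `B (inl a) (inl a') = B a a'`; `B (inl a) ★ (u,w,w',u') = 𝟙{w' = u} Ec^{κ,a}(u,w,u')`;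
  `B ★ (inl a') = Eo^{κ,a'}`; `B ★ ★ (u,w,w',u') = 𝟙{w' = u} Eoc^κ(u,w,u')`; `A (inl a) (inl c) = A a c`;
  `A ★ (inl c) (u,w,t,z) = 𝟙{z = w} EA^{κ,c}(u,w,t)`; `★`-columns of `A` and the `★`-entry of `P^E` vanish);
* translation invariance is inherited (`isTransInv_starB`, `isTransInv_starA`; three-point `IsTransInv₃`);
* the matrix ENTRIES: `matB (starB …)` is the block matrix `[[B, Ec-column], [Eo-row, Eoc]]` with
  `normEc Ec a = sup_v Σ_y Σ_κ Ec^{κ,a}(0,v,y)` (the Kronecker collapses the `x`-sum exactly — the only supremum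
  over the pin displacement is the one `matB` already takes), `normEo Eo a' = sup_v Σ_{x,y} Σ_κ Eo^{κ,a'}(0,v,x,y)`,
  `normEoc`; `matAbar (starA …) = [[Ā, 0], [EA-row, 0]]` with `normEA EA c = sup_v sup_t Σ_κ EA^{κ,c}(0,v,t)` (a
  DOUBLE supremum: `matAbar` is the double-open norm); `vecP (starS S) = (P⃗, 0)`
  (`matB_starB_eq_fromBlocks`, `matAbar_starA_eq_fromBlocks`, `vecP_starS`);
* the exact `vecMul` recursion over `(inl | ★)` (`vecMul_matB_starB`, `vecMul_matAbar_starA_dotProduct`) — the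
  algebra by which the special part is priced separately from the printed `P⃗^S B^M Ā P⃗^E` — and the consistency
  check `star_chain_eq_of_zero` (all four special families `0` ⇒ the extended chain IS the printed chain);
* the (5.34)-type bound over `ι ⊕ Unit` (`tsum_le_star_chain`: an `x`-space bound against
  `recP (starS S) (starB …)` sums to `(P⃗,0) · matB(starB)^M · matAbar(starA) · (P⃗^E,0)`);
* the SECTION families (`secEo Bpt a₂`: the `z = w` section of a pointwise regular block with entry class `a₂`;
  `secEc Bpt a₀`: the exit-class-`a₀`, `w' = u'` section; `secEoc`; `secEA A a₂`) and the KERNEL DOMINATIONS of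
  their norms by the printed entries (`normEo_secEo_le`, `normEc_secEc_le`, `normEoc_secEoc_le`,
  `normEA_secEA_le`, `matB_starB_sec_le`, `matAbar_starA_sec_le`) together with the monotonicity of the chain
  value in its matrices (`star_chain_mono`): IF the special-slot class estimates hold against the section
  families, the extended chain is bounded by the printed matrices bordered with their class-`a₂` row and
  class-`a₀` column — a kernel inequality, no new diagrammatic element.

Nothing here is percolation-specific and nothing is cited as a fact; the module is ADDITIVE (`BlockSummation` is
not modified).
-/

noncomputable section

namespace Literature.Probability.FitznerVanDerHofstad2017.BlockSummation

open scoped BigOperators ENNReal Matrix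

variable {G ι K : Type*}

/-! ### 1. The extended families -/

/-- Translation invariance of a three-point kernel. [folklore] -/
def IsTransInv₃ [AddCommGroup G] (M : G → G → G → ℝ≥0∞) : Prop :=
  ∀ g u v x, M (u + g) (v + g) (x + g) = M u v x

/-- The extended start (or end) piece: `S` on the regular classes, `0` on `★`.
[cite: FitznerVanDerHofstad2017, §6.2.1 (6.48) (arXiv:1506.07977v2 p. 65)] -/
def starS (S : ι → G → G → ℝ≥0∞) : ι ⊕ Unit → G → G → ℝ≥0∞
  | Sum.inl a => S a
  | Sum.inr _ => fun _ _ => 0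

/-- The extended middle block over `ι ⊕ Unit`: `B` on regular/regular; `𝟙{w' = u} Ec^{κ,a}(u,w,u')` on
regular/`★` (closed level, the pin `u` handed on in the slot `w'`); `Eo^{κ,a'}(u,w,w',u')` on `★`/regular (pinned
level, pin in the slot `w`); `𝟙{w' = u} Eoc^κ(u,w,u')` on `★`/`★`.
[cite: FitznerVanDerHofstad2017, §5.1 (5.4) (arXiv:1506.07977v2 p. 48); §6.2.1 (6.49) (p. 65)] -/
def starB [DecidableEq G] (B : K → ι → ι → G → G → G → G → ℝ≥0∞) (Ec : K → ι → G → G → G → ℝ≥0∞)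
    (Eo : K → ι → G → G → G → G → ℝ≥0∞) (Eoc : K → G → G → G → ℝ≥0∞) :
    K → ι ⊕ Unit → ι ⊕ Unit → G → G → G → G → ℝ≥0∞
  | κ, Sum.inl a, Sum.inl a' => B κ a a'
  | κ, Sum.inl a, Sum.inr _ => fun u w w' u' => if w' = u then Ec κ a u w u' else 0
  | κ, Sum.inr _, Sum.inl a' => Eo κ a'
  | κ, Sum.inr _, Sum.inr _ => fun u w w' u' => if w' = u then Eoc κ u w u' else 0

/-- The extended terminal block: `A` on regular rows, `𝟙{z = w} EA^{κ,c}(u,w,t)` on the `★`-row (pinned last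
piece: its line `t → z` ends at the pin `w`), `0` on the `★`-column (the terminal class is never special).
[cite: FitznerVanDerHofstad2017, §5.1 "Elements of the bounds" (arXiv:1506.07977v2 p. 49); Lemma 6.1 (6.51) (p. 66)] -/
def starA [DecidableEq G] (A : K → ι → ι → G → G → G → G → ℝ≥0∞) (EA : K → ι → G → G → G → ℝ≥0∞) :
    K → ι ⊕ Unit → ι ⊕ Unit → G → G → G → G → ℝ≥0∞
  | κ, Sum.inl a, Sum.inl c => A κ a c
  | κ, Sum.inr _, Sum.inl c => fun u w t z => if z = w then EA κ c u w t else 0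
  | _, Sum.inl _, Sum.inr _ => fun _ _ _ _ => 0
  | _, Sum.inr _, Sum.inr _ => fun _ _ _ _ => 0

section SimpS

variable (S : ι → G → G → ℝ≥0∞)

/-- [folklore] -/
@[simp] theorem starS_inl (a : ι) : starS S (Sum.inl a) = S a := rfl

/-- [folklore] -/
@[simp] theorem starS_inr (s : Unit) (x y : G) : starS S (Sum.inr s) x y = 0 := rfl

/-- [folklore] -/
@[simp] theorem vecP_starS_inl (a : ι) : vecP (starS S) (Sum.inl a) = vecP S a := rfl

/-- [folklore] -/
@[simp] theorem vecP_starS_inr (s : Unit) : vecP (starS S) (Sum.inr s) = 0 := by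
  simp [vecP, pairSum]

/-- `P⃗(starS S) = (P⃗ S, 0)`. [folklore] -/
theorem vecP_starS : vecP (starS S) = Sum.elim (vecP S) 0 := by
  funext x; rcases x with a | s
  · rfl
  · exact vecP_starS_inr S s

end SimpS

section Simp

variable [DecidableEq G] (B : K → ι → ι → G → G → G → G → ℝ≥0∞)
  (Ec : K → ι → G → G → G → ℝ≥0∞) (Eo : K → ι → G → G → G → G → ℝ≥0∞) (Eoc : K → G → G → G → ℝ≥0∞)
  (A : K → ι → ι → G → G → G → G → ℝ≥0∞) (EA : K → ι → G → G → G → ℝ≥0∞)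

/-- [folklore] -/
@[simp] theorem starB_inl_inl (κ : K) (a a' : ι) : starB B Ec Eo Eoc κ (Sum.inl a) (Sum.inl a') = B κ a a' := rfl

/-- [folklore] -/
@[simp] theorem starB_inl_inr (κ : K) (a : ι) (s : Unit) (u w w' u' : G) :
    starB B Ec Eo Eoc κ (Sum.inl a) (Sum.inr s) u w w' u' = if w' = u then Ec κ a u w u' else 0 := rfl

/-- [folklore] -/
@[simp] theorem starB_inr_inl (κ : K) (s : Unit) (a' : ι) : starB B Ec Eo Eoc κ (Sum.inr s) (Sum.inl a') = Eo κ a' :=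
  rfl

/-- [folklore] -/
@[simp] theorem starB_inr_inr (κ : K) (s s' : Unit) (u w w' u' : G) :
    starB B Ec Eo Eoc κ (Sum.inr s) (Sum.inr s') u w w' u' = if w' = u then Eoc κ u w u' else 0 := rfl

/-- [folklore] -/
@[simp] theorem starA_inl_inl (κ : K) (a c : ι) : starA A EA κ (Sum.inl a) (Sum.inl c) = A κ a c := rfl

/-- [folklore] -/
@[simp] theorem starA_inr_inl (κ : K) (s : Unit) (c : ι) (u w t z : G) :
    starA A EA κ (Sum.inr s) (Sum.inl c) u w t z = if z = w then EA κ c u w t else 0 := rfl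

/-- [folklore] -/
@[simp] theorem starA_inr (κ : K) (x : ι ⊕ Unit) (s : Unit) (u w t z : G) :
    starA A EA κ x (Sum.inr s) u w t z = 0 := by
  cases x <;> rfl

/-- A Kronecker in the summed variable collapses the sum. [folklore] -/
theorem tsum_ite_eq_zero_left (f : G → ℝ≥0∞) (u : G) : ∑' x, (if x = u then f x else 0) = f u := by
  rw [tsum_eq_single u fun x hx => by simp [hx]]
  simp

end Simp

variable [AddCommGroup G]

/-! ### 2. Translation invariance is inherited -/

/-- [folklore] -/
theorem isTransInv_starB [DecidableEq G] {B : K → ι → ι → G → G → G → G → ℝ≥0∞}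
    {Ec : K → ι → G → G → G → ℝ≥0∞} {Eo : K → ι → G → G → G → G → ℝ≥0∞} {Eoc : K → G → G → G → ℝ≥0∞}
    (hB : ∀ κ a a', IsTransInv (B κ a a')) (hEc : ∀ κ a, IsTransInv₃ (Ec κ a))
    (hEo : ∀ κ a', IsTransInv (Eo κ a')) (hEoc : ∀ κ, IsTransInv₃ (Eoc κ)) :
    ∀ κ x y, IsTransInv (starB B Ec Eo Eoc κ x y)
  | κ, Sum.inl a, Sum.inl a' => hB κ a a'
  | κ, Sum.inl a, Sum.inr _ => fun g u w w' u' => by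
      simp only [starB_inl_inr, add_left_inj, hEc κ a g u w u']
  | κ, Sum.inr _, Sum.inl a' => hEo κ a'
  | κ, Sum.inr _, Sum.inr _ => fun g u w w' u' => by
      simp only [starB_inr_inr, add_left_inj, hEoc κ g u w u']

/-- [folklore] -/
theorem isTransInv_starA [DecidableEq G] {A : K → ι → ι → G → G → G → G → ℝ≥0∞}
    {EA : K → ι → G → G → G → ℝ≥0∞} (hA : ∀ κ a c, IsTransInv (A κ a c)) (hEA : ∀ κ c, IsTransInv₃ (EA κ c)) :
    ∀ κ x y, IsTransInv (starA A EA κ x y)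
  | κ, Sum.inl a, Sum.inl c => hA κ a c
  | κ, Sum.inr _, Sum.inl c => fun g u w t z => by
      simp only [starA_inr_inl, add_left_inj, hEA κ c g u w t]
  | κ, Sum.inl _, Sum.inr _ => fun g u w t z => rfl
  | κ, Sum.inr _, Sum.inr _ => fun g u w t z => rfl

/-! ### 3. The special norms and the matrix entries -/

/-- `sup_v Σ_y Σ_κ Ec^{κ,a}(0,v,y)` — the matrix entry of the closed special block. [folklore] -/
def normEc [Fintype K] (Ec : K → ι → G → G → G → ℝ≥0∞) (a : ι) : ℝ≥0∞ := ⨆ v, ∑' y, ∑ κ, Ec κ a 0 v y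

/-- `sup_v Σ_{x,y} Σ_κ Eo^{κ,a'}(0,v,x,y)` — the matrix entry of the pinned special block (`v` = the pin). [folklore] -/
def normEo [Fintype K] (Eo : K → ι → G → G → G → G → ℝ≥0∞) (a' : ι) : ℝ≥0∞ :=
  ⨆ v, ∑' x, ∑' y, ∑ κ, Eo κ a' 0 v x y

/-- `sup_v Σ_y Σ_κ Eoc^κ(0,v,y)`. [folklore] -/
def normEoc [Fintype K] (Eoc : K → G → G → G → ℝ≥0∞) : ℝ≥0∞ := ⨆ v, ∑' y, ∑ κ, Eoc κ 0 v y

/-- `sup_v sup_t Σ_κ EA^{κ,c}(0,v,t)` — the matrix entry of the pinned terminal block (a DOUBLE supremum: the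
double-open norm `matAbar` takes `sup` over the exit displacement, which the pin fixes). [folklore] -/
def normEA [Fintype K] (EA : K → ι → G → G → G → ℝ≥0∞) (c : ι) : ℝ≥0∞ := ⨆ v, ⨆ t, ∑ κ, EA κ c 0 v t

section Entries

variable [DecidableEq G] [Fintype K] (B : K → ι → ι → G → G → G → G → ℝ≥0∞)
  (Ec : K → ι → G → G → G → ℝ≥0∞) (Eo : K → ι → G → G → G → G → ℝ≥0∞) (Eoc : K → G → G → G → ℝ≥0∞)
  (A : K → ι → ι → G → G → G → G → ℝ≥0∞) (EA : K → ι → G → G → G → ℝ≥0∞)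

/-- [folklore] -/
@[simp] theorem matB_starB_inl_inl (a a' : ι) : matB (starB B Ec Eo Eoc) (Sum.inl a) (Sum.inl a') = matB B a a' := by
  simp only [matB_apply, starB_inl_inl]

/-- The closed special entry: the Kronecker `𝟙{x = 0}` collapses the `x`-sum exactly. [folklore] -/
@[simp] theorem matB_starB_inl_inr (a : ι) (s : Unit) :
    matB (starB B Ec Eo Eoc) (Sum.inl a) (Sum.inr s) = normEc Ec a := by
  simp only [matB_apply, starB_inl_inr, normEc]
  refine iSup_congr fun v => ?_
  have h : ∀ x y : G, (∑ κ, if x = (0 : G) then Ec κ a 0 v y else 0) =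
      if x = 0 then ∑ κ, Ec κ a 0 v y else 0 := fun x y => by
    split_ifs <;> simp
  simp_rw [h]
  have h' : ∀ x : G, (∑' y, if x = (0 : G) then ∑ κ, Ec κ a 0 v y else 0) =
      if x = 0 then ∑' y, ∑ κ, Ec κ a 0 v y else 0 := fun x => by
    split_ifs <;> simp
  simp_rw [h']
  exact tsum_ite_eq_zero_left _ 0

/-- [folklore] -/
@[simp] theorem matB_starB_inr_inl (s : Unit) (a' : ι) :
    matB (starB B Ec Eo Eoc) (Sum.inr s) (Sum.inl a') = normEo Eo a' := by
  simp only [matB_apply, starB_inr_inl, normEo]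

/-- [folklore] -/
@[simp] theorem matB_starB_inr_inr (s s' : Unit) :
    matB (starB B Ec Eo Eoc) (Sum.inr s) (Sum.inr s') = normEoc Eoc := by
  simp only [matB_apply, starB_inr_inr, normEoc]
  refine iSup_congr fun v => ?_
  have h : ∀ x y : G, (∑ κ, if x = (0 : G) then Eoc κ 0 v y else 0) =
      if x = 0 then ∑ κ, Eoc κ 0 v y else 0 := fun x y => by
    split_ifs <;> simp
  simp_rw [h]
  have h' : ∀ x : G, (∑' y, if x = (0 : G) then ∑ κ, Eoc κ 0 v y else 0) =
      if x = 0 then ∑' y, ∑ κ, Eoc κ 0 v y else 0 := fun x => by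
    split_ifs <;> simp
  simp_rw [h']
  exact tsum_ite_eq_zero_left _ 0

/-- [folklore] -/
@[simp] theorem matAbar_starA_inl_inl (a c : ι) : matAbar (starA A EA) (Sum.inl a) (Sum.inl c) = matAbar A a c := by
  simp only [matAbar_apply, starA_inl_inl]

/-- [folklore] -/
@[simp] theorem matAbar_starA_inr_right (x : ι ⊕ Unit) (s : Unit) : matAbar (starA A EA) x (Sum.inr s) = 0 := by
  simp [matAbar_apply]

/-- The pinned terminal entry: `sup_{v,y} Σ_x Σ_κ 𝟙{x + y = v} EA^{κ,c}(0,v,x) = sup_v sup_t Σ_κ EA^{κ,c}(0,v,t)`.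
[folklore] -/
@[simp] theorem matAbar_starA_inr_inl (s : Unit) (c : ι) :
    matAbar (starA A EA) (Sum.inr s) (Sum.inl c) = normEA EA c := by
  simp only [matAbar_apply, starA_inr_inl, normEA]
  refine iSup_congr fun v => ?_
  have h : ∀ x y : G, (∑ κ, if x + y = v then EA κ c 0 v x else 0) =
      if x = v - y then ∑ κ, EA κ c 0 v x else 0 := fun x y => by
    by_cases hx : x = v - y
    · rw [if_pos hx]
      exact Finset.sum_congr rfl fun κ _ => if_pos (by rw [hx, sub_add_cancel])
    · rw [if_neg hx]
      exact Finset.sum_eq_zero fun κ _ => if_neg fun h' => hx (eq_sub_of_add_eq h')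
  simp_rw [h, tsum_ite_eq_zero_left]
  have hs : Function.Surjective fun y : G => v - y := fun t => ⟨v - t, sub_sub_cancel v t⟩
  exact hs.iSup_comp fun t => ∑ κ, EA κ c 0 v t

/-- **Block form of the extended middle matrix**: `matB (starB B Ec Eo Eoc) = [[B, Ec], [Eo, Eoc]]`. [folklore] -/
theorem matB_starB_eq_fromBlocks :
    matB (starB B Ec Eo Eoc) = Matrix.fromBlocks (matB B) (Matrix.of fun a _ => normEc Ec a)
      (Matrix.of fun _ a' => normEo Eo a') (Matrix.of fun _ _ => normEoc Eoc) := by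
  ext (a | s) (a' | s') <;> simp

/-- **Block form of the extended terminal matrix**: `matAbar (starA A EA) = [[Ā, 0], [EA, 0]]`. [folklore] -/
theorem matAbar_starA_eq_fromBlocks :
    matAbar (starA A EA) = Matrix.fromBlocks (matAbar A) 0 (Matrix.of fun _ c => normEA EA c) 0 := by
  ext (a | s) (c | s') <;> simp

/-! ### 4. The exact recursion over `(regular | ★)` and the consistency check -/

/-- One step of the row-vector recursion: `x · matB(starB) = (x_reg · B + x_★ · Eo-row, x_reg · Ec-col + x_★ · Eoc)`.
[folklore] -/
theorem vecMul_matB_starB [Fintype ι] (x : ι ⊕ Unit → ℝ≥0∞) :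
    x ᵥ* matB (starB B Ec Eo Eoc) =
      Sum.elim ((x ∘ Sum.inl) ᵥ* matB B + (x ∘ Sum.inr) ᵥ* Matrix.of fun _ a' => normEo Eo a')
        ((x ∘ Sum.inl) ᵥ* (Matrix.of fun a _ => normEc Ec a) + (x ∘ Sum.inr) ᵥ* Matrix.of fun _ _ => normEoc Eoc) := by
  rw [matB_starB_eq_fromBlocks, Matrix.vecMul_fromBlocks]

/-- The terminal pairing: `y · matAbar(starA) · (P⃗^E, 0) = (y_reg · Ā + y_★ · EA-row) · P⃗^E`. [folklore] -/
theorem vecMul_matAbar_starA_dotProduct [Fintype ι] (y : ι ⊕ Unit → ℝ≥0∞) (PE : ι → G → G → ℝ≥0∞) :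
    y ᵥ* matAbar (starA A EA) ⬝ᵥ vecP (starS PE) =
      ((y ∘ Sum.inl) ᵥ* matAbar A + (y ∘ Sum.inr) ᵥ* Matrix.of fun _ c => normEA EA c) ⬝ᵥ vecP PE := by
  rw [matAbar_starA_eq_fromBlocks, Matrix.vecMul_fromBlocks, vecP_starS, sumElim_dotProduct_sumElim]
  simp

end Entries

/-- **Consistency**: with all four special families `0` the extended chain value IS the printed one,
`(P⃗,0) · matB(starB B 0 0 0)^M · matAbar(starA A 0) · (P⃗^E,0) = P⃗ · B^M · Ā · P⃗^E`. [folklore] -/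
theorem star_chain_eq_of_zero [DecidableEq G] [Fintype ι] [DecidableEq ι] [Fintype K]
    (S PE : ι → G → G → ℝ≥0∞) (B A : K → ι → ι → G → G → G → G → ℝ≥0∞) (M : ℕ) :
    vecP (starS S) ᵥ* matB (starB B 0 0 0) ^ M ᵥ* matAbar (starA A 0) ⬝ᵥ vecP (starS PE) =
      vecP S ᵥ* matB B ^ M ᵥ* matAbar A ⬝ᵥ vecP PE := by
  have hB : matB (starB B (0 : K → ι → G → G → G → ℝ≥0∞) 0 0) = Matrix.fromBlocks (matB B) 0 0 0 := by
    rw [matB_starB_eq_fromBlocks]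
    congr 1 <;> ext <;> simp [normEc, normEo, normEoc]
  have h1 : vecP (starS S) ᵥ* matB (starB B (0 : K → ι → G → G → G → ℝ≥0∞) 0 0) ^ M =
      Sum.elim (vecP S ᵥ* matB B ^ M) 0 := by
    rw [hB, Matrix.fromBlocks_diagonal_pow, vecP_starS, Matrix.vecMul_fromBlocks]
    simp
  rw [h1, vecMul_matAbar_starA_dotProduct]
  simp

/-! ### 5. The (5.34)-type chain bound over `ι ⊕ Unit` -/

/-- **(5.34) over the extended class index.**  If `Ξ(x) ≤ Σ_{u,w,t,z} Σ_κ Σ_{a,b ∈ ι ⊕ ★}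
P^{(M),a}_★(u,w) A_★^{κ,a,b}(u,w,t,z) P^{E,b}_★(z−x,t−x)` for every `x` (exit arguments in the (5.34) order of
`BlockSummation.tsum_le_vecMul_pow_dotProduct`; the (6.4) order is `NobleBlocksAvgPerc`'s primed variant), with
`P^{(M)}_★ = recP (starS S) (starB …)`, then `Σ_x Ξ(x) ≤ (P⃗,0) · matB(starB)^M · matAbar(starA) · (P⃗^E,0)`.
[cite: FitznerVanDerHofstad2017, Prop. 5.5 (5.34) (arXiv:1506.07977v2 p. 53); §6.2.1 (6.48)–(6.49), Lemma 6.1 (pp. 65–67); §6.1 (6.4)–(6.5) (p. 58)] -/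
theorem tsum_le_star_chain [DecidableEq G] [Fintype ι] [DecidableEq ι] [Fintype K]
    {B A : K → ι → ι → G → G → G → G → ℝ≥0∞} {Ec EA : K → ι → G → G → G → ℝ≥0∞}
    {Eo : K → ι → G → G → G → G → ℝ≥0∞} {Eoc : K → G → G → G → ℝ≥0∞}
    (hB : ∀ κ a a', IsTransInv (B κ a a')) (hEc : ∀ κ a, IsTransInv₃ (Ec κ a))
    (hEo : ∀ κ a', IsTransInv (Eo κ a')) (hEoc : ∀ κ, IsTransInv₃ (Eoc κ))
    (hA : ∀ κ a c, IsTransInv (A κ a c)) (hEA : ∀ κ c, IsTransInv₃ (EA κ c))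
    (Ξ : G → ℝ≥0∞) (S PE : ι → G → G → ℝ≥0∞) (M : ℕ)
    (hΞ : ∀ x, Ξ x ≤ ∑' u, ∑' w, ∑' t, ∑' z, ∑ κ, ∑ a : ι ⊕ Unit, ∑ b : ι ⊕ Unit,
      recP (starS S) (starB B Ec Eo Eoc) M a u w * starA A EA κ a b u w t z * starS PE b (z - x) (t - x)) :
    ∑' x, Ξ x ≤ vecP (starS S) ᵥ* matB (starB B Ec Eo Eoc) ^ M ᵥ* matAbar (starA A EA) ⬝ᵥ vecP (starS PE) :=
  tsum_le_vecMul_pow_dotProduct (isTransInv_starB hB hEc hEo hEoc) (isTransInv_starA hA hEA) Ξ (starS S)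
    (starS PE) M hΞ

/-! ### 6. Monotonicity of the chain value in its matrices -/

section Mono

variable {m : Type*} [Fintype m]

/-- [folklore] -/
theorem vecMul_mono {x x' : m → ℝ≥0∞} {P P' : Matrix m m ℝ≥0∞} (hx : ∀ i, x i ≤ x' i)
    (hP : ∀ i j, P i j ≤ P' i j) : ∀ j, (x ᵥ* P) j ≤ (x' ᵥ* P') j := fun j =>
  Finset.sum_le_sum fun i _ => mul_le_mul' (hx i) (hP i j)

/-- [folklore] -/
theorem dotProduct_mono {x x' y y' : m → ℝ≥0∞} (hx : ∀ i, x i ≤ x' i) (hy : ∀ i, y i ≤ y' i) :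
    x ⬝ᵥ y ≤ x' ⬝ᵥ y' :=
  Finset.sum_le_sum fun i _ => mul_le_mul' (hx i) (hy i)

/-- [folklore] -/
theorem matrix_mul_mono {P P' Q Q' : Matrix m m ℝ≥0∞} (hP : ∀ i j, P i j ≤ P' i j) (hQ : ∀ i j, Q i j ≤ Q' i j) :
    ∀ i j, (P * Q) i j ≤ (P' * Q') i j :=
  fun i j => Finset.sum_le_sum fun k _ => mul_le_mul' (hP i k) (hQ k j)

/-- [folklore] -/
theorem matrix_pow_mono [DecidableEq m] {P P' : Matrix m m ℝ≥0∞} (hP : ∀ i j, P i j ≤ P' i j) :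
    ∀ (M : ℕ) (i j), (P ^ M) i j ≤ (P' ^ M) i j
  | 0 => fun i j => by simp
  | M + 1 => fun i j => by
      rw [pow_succ, pow_succ]
      exact matrix_mul_mono (matrix_pow_mono hP M) hP i j

/-- The chain value `x · P^M · Q · y` is monotone in `(x, P, Q, y)` (entrywise). [folklore] -/
theorem star_chain_mono [DecidableEq m] {x x' y y' : m → ℝ≥0∞} {P P' Q Q' : Matrix m m ℝ≥0∞}
    (hx : ∀ i, x i ≤ x' i) (hP : ∀ i j, P i j ≤ P' i j) (hQ : ∀ i j, Q i j ≤ Q' i j) (hy : ∀ i, y i ≤ y' i)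
    (M : ℕ) : x ᵥ* P ^ M ᵥ* Q ⬝ᵥ y ≤ x' ᵥ* P' ^ M ᵥ* Q' ⬝ᵥ y' :=
  dotProduct_mono (vecMul_mono (vecMul_mono hx (matrix_pow_mono hP M)) hQ) hy

end Mono

/-! ### 7. The section families and their kernel dominations -/

/-- The PINNED block as the `z = w` SECTION of a pointwise regular block with entry class `a₂`:
`Eo^{κ,a'}(u,w,w',u') := Σ_t Bpt^{κ,a₂,a'}(u,w,t,w,w',u')`.
[cite: FitznerVanDerHofstad2017, §5.1 (5.4) (arXiv:1506.07977v2 p. 48)] -/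
def secEo (Bpt : K → ι → ι → G → G → G → G → G → G → ℝ≥0∞) (a₂ : ι) : K → ι → G → G → G → G → ℝ≥0∞ :=
  fun κ a' u w w' u' => ∑' t, Bpt κ a₂ a' u w t w w' u'

/-- The CLOSED block as the exit-class-`a₀`, `w' = u'` SECTION: `Ec^{κ,a}(u,w,u') := Σ_{t,z} Bpt^{κ,a,a₀}(u,w,t,z,u',u')`.
[cite: FitznerVanDerHofstad2017, §5.1 (5.4) (arXiv:1506.07977v2 p. 48)] -/
def secEc (Bpt : K → ι → ι → G → G → G → G → G → G → ℝ≥0∞) (a₀ : ι) : K → ι → G → G → G → ℝ≥0∞ :=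
  fun κ a u w u' => ∑' t, ∑' z, Bpt κ a a₀ u w t z u' u'

/-- The PINNED-AND-CLOSED block: `Eoc^κ(u,w,u') := Σ_t Bpt^{κ,a₂,a₀}(u,w,t,w,u',u')`.
[cite: FitznerVanDerHofstad2017, §5.1 (5.4) (arXiv:1506.07977v2 p. 48)] -/
def secEoc (Bpt : K → ι → ι → G → G → G → G → G → G → ℝ≥0∞) (a₂ a₀ : ι) : K → G → G → G → ℝ≥0∞ :=
  fun κ u w u' => ∑' t, Bpt κ a₂ a₀ u w t w u' u'

/-- The PINNED TERMINAL block as the `z = w` section of the row `a₂` of a double-open family: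
`EA^{κ,c}(u,w,t) := A^{κ,a₂,c}(u,w,t,w)`.
[cite: FitznerVanDerHofstad2017, §5.1 "Elements of the bounds" (arXiv:1506.07977v2 p. 49)] -/
def secEA (A : K → ι → ι → G → G → G → G → ℝ≥0∞) (a₂ : ι) : K → ι → G → G → G → ℝ≥0∞ :=
  fun κ c u w t => A κ a₂ c u w t w

section Dominations

variable [Fintype K]

/-- `normEA (secEA A a₂) c ≤ (Ā)_{a₂,c}`: the pinned terminal entry is dominated by the printed row `a₂`. [folklore] -/
theorem normEA_secEA_le (A : K → ι → ι → G → G → G → G → ℝ≥0∞) (a₂ c : ι) :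
    normEA (secEA A a₂) c ≤ matAbar A a₂ c := by
  rw [normEA, matAbar_apply]
  refine iSup_mono fun v => iSup_le fun t => le_iSup_of_le (v - t) ?_
  calc ∑ κ, secEA A a₂ κ c 0 v t = ∑ κ, A κ a₂ c 0 v t (t + (v - t)) := by simp [secEA, add_sub_cancel]
    _ ≤ ∑' x, ∑ κ, A κ a₂ c 0 v x (x + (v - t)) := ENNReal.le_tsum (f := fun x => ∑ κ, A κ a₂ c 0 v x (x + (v - t))) t

/-- The same for the terminal matrix: `matAbar (starA A (secEA A a₂)) ≤ [[Ā, 0], [Ā_{a₂,·}, 0]]`. [folklore] -/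
theorem matAbar_starA_sec_le [DecidableEq G] (A : K → ι → ι → G → G → G → G → ℝ≥0∞) (a₂ : ι) : ∀ i j,
    matAbar (starA A (secEA A a₂)) i j ≤
      Matrix.fromBlocks (matAbar A) 0 (Matrix.of fun _ c => matAbar A a₂ c) 0 i j := by
  rw [matAbar_starA_eq_fromBlocks]
  rintro (a | s) (c | s')
  · exact le_rfl
  · exact le_rfl
  · exact normEA_secEA_le A a₂ c
  · exact le_rfl

variable {Bpt : K → ι → ι → G → G → G → G → G → G → ℝ≥0∞} {B : K → ι → ι → G → G → G → G → ℝ≥0∞}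
  (hBpt : ∀ κ a a' u w w' u', ∑' t, ∑' z, Bpt κ a a' u w t z w' u' ≤ B κ a a' u w w' u')
include hBpt

/-- `normEo (secEo Bpt a₂) a' ≤ (B)_{a₂,a'}`: the pinned entry is dominated by the printed row `a₂`. [folklore] -/
theorem normEo_secEo_le (a₂ a' : ι) : normEo (secEo Bpt a₂) a' ≤ matB B a₂ a' := by
  rw [normEo, matB_apply]
  refine iSup_mono fun v => ENNReal.tsum_le_tsum fun x => ENNReal.tsum_le_tsum fun y =>
    Finset.sum_le_sum fun κ _ => le_trans ?_ (hBpt κ a₂ a' 0 v x y)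
  exact ENNReal.tsum_le_tsum fun t => ENNReal.le_tsum (f := fun z => Bpt κ a₂ a' 0 v t z x y) v

/-- `normEc (secEc Bpt a₀) a ≤ (B)_{a,a₀}`: the closed entry is dominated by the printed column `a₀`. [folklore] -/
theorem normEc_secEc_le (a a₀ : ι) : normEc (secEc Bpt a₀) a ≤ matB B a a₀ := by
  rw [normEc, matB_apply]
  refine iSup_mono fun v => ?_
  calc ∑' y, ∑ κ, secEc Bpt a₀ κ a 0 v y
      ≤ ∑' y, ∑ κ, B κ a a₀ 0 v y y :=
        ENNReal.tsum_le_tsum fun y => Finset.sum_le_sum fun κ _ => hBpt κ a a₀ 0 v y y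
    _ ≤ ∑' y, ∑' x, ∑ κ, B κ a a₀ 0 v x y :=
        ENNReal.tsum_le_tsum fun y => ENNReal.le_tsum (f := fun x => ∑ κ, B κ a a₀ 0 v x y) y
    _ = ∑' x, ∑' y, ∑ κ, B κ a a₀ 0 v x y := ENNReal.tsum_comm

/-- `normEoc (secEoc Bpt a₂ a₀) ≤ (B)_{a₂,a₀}`. [folklore] -/
theorem normEoc_secEoc_le (a₂ a₀ : ι) : normEoc (secEoc Bpt a₂ a₀) ≤ matB B a₂ a₀ := by
  rw [normEoc, matB_apply]
  refine iSup_mono fun v => ?_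
  calc ∑' y, ∑ κ, secEoc Bpt a₂ a₀ κ 0 v y
      ≤ ∑' y, ∑ κ, B κ a₂ a₀ 0 v y y :=
        ENNReal.tsum_le_tsum fun y => Finset.sum_le_sum fun κ _ => le_trans
          (ENNReal.tsum_le_tsum fun t => ENNReal.le_tsum (f := fun z => Bpt κ a₂ a₀ 0 v t z y y) v)
          (hBpt κ a₂ a₀ 0 v y y)
    _ ≤ ∑' y, ∑' x, ∑ κ, B κ a₂ a₀ 0 v x y :=
        ENNReal.tsum_le_tsum fun y => ENNReal.le_tsum (f := fun x => ∑ κ, B κ a₂ a₀ 0 v x y) y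
    _ = ∑' x, ∑' y, ∑ κ, B κ a₂ a₀ 0 v x y := ENNReal.tsum_comm

/-- **Size model as a kernel inequality**: under the section choice the extended middle matrix is dominated
entrywise by the printed matrix bordered with its row `a₂` and column `a₀`,
`matB (starB B (secEc Bpt a₀) (secEo Bpt a₂) (secEoc Bpt a₂ a₀)) ≤ [[B, B_{·,a₀}], [B_{a₂,·}, B_{a₂,a₀}]]`. [folklore] -/
theorem matB_starB_sec_le [DecidableEq G] (a₂ a₀ : ι) : ∀ i j,
    matB (starB B (secEc Bpt a₀) (secEo Bpt a₂) (secEoc Bpt a₂ a₀)) i j ≤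
      Matrix.fromBlocks (matB B) (Matrix.of fun a _ => matB B a a₀) (Matrix.of fun _ a' => matB B a₂ a')
        (Matrix.of fun _ _ => matB B a₂ a₀) i j := by
  rw [matB_starB_eq_fromBlocks]
  rintro (a | s) (a' | s')
  · exact le_rfl
  · exact normEc_secEc_le hBpt a a₀
  · exact normEo_secEo_le hBpt a₂ a'
  · exact normEoc_secEoc_le hBpt a₂ a₀

end Dominations

end Literature.Probability.FitznerVanDerHofstad2017.BlockSummation

end
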